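import Summits.ABC.IUTFork.Cor312VolumesPadicLatticeScaledHull
import Summits.ABC.IUTFork.Cor312ThetaFiniteDHVol
import Summits.ABC.IUTFork.Cor312PilotIdelesDH
import HarnessLib

/-!
# [IUTchIII] Corollary 3.12, statement — `^{n,∘}𝒰` COMPUTED and (Ind1),(Ind2)-STABLE at every unramified odd prime
# for summand-wise `ℚ_p`-SCALED Θ-boxes of the real setting (one-set stability `hst` beyond the unit boxes)

Record-only file (D-0012) of the abc-iut cell (Cor. 3.12 sub-crew, seat abc-iut-c312-5, gen 4); TAKES NO SIDE.
abc-iut-w5-d060's `Cor312HullGluedStable` (p424693) reduced the hull-gluing bracket of [IUTchIII] Cor. 3.12 (kurims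
`paper:url-4b091feeb646` p. 173 l. 41 – p. 174 l. 19; proof p. 174 l. 50 – p. 175 l. 1: "`^{n,∘}𝒰_{j,v_ℚ}` … the
holomorphic hull of the union of the possible images") to ONE-SET STABILITY `hst` of `^{n,∘}𝒰_{j,v_ℚ}` under the
indeterminacy group, and `Cor312HullGluedDHVol` (p425664) proved `hst` at c312-5's setting of record `Real.settingDHVol`
at the packets `(j, p)`, `p` odd, `p ∤ disc(F)`, where the union of the Θ-boxes IS the unit polydisc `𝒪_L`, naming
the other packets open. THIS FILE settles the next class: Θ-boxes that are, summand by summand, `ℚ_p`-SCALAR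
multiples `c(v⃗)·(R_{v⃗})^∼` of the normalised packet — the shape of abc-iut-c312-3's sharp idele boxes
`ι_j(t_{Θ,j,v_j})·(R_I)^∼` (Dupuy–Hilado §3.9) at every unramified prime, with ARBITRARY (not unit, not rational)
ideles, since there `‖t‖ ∈ p^ℤ = |ℚ_p^×|`. For such boxes at an odd `p ∤ disc(F)` and a label `j = i+1 ∈ 𝔽_l^⋇`:

* §2 at `Real.settingDHVol` with c312-3's boxes `thetaBoxDH B`, `B_{p,j,v⃗} = c(v⃗)·(R_{v⃗})^∼` at the packet:
  the (Ind3)-region is `e⁻¹(Π c(v⃗)·I_{v⃗})` (`thetaRegion3_eq_latticePkS`); the union of ALL possible images is the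
  union over the capsule permutations `σ` of `e⁻¹(Π c(v⃗∘σ)·I_{v⃗})` (`sUnion_possibleImages_eq`); and
  **`thetaHull_eq_latticePkS`**: `^{n,∘}𝒰_{i+1,p} = e⁻¹(Π_{v⃗} ĉ(v⃗)·I_{v⃗})` for ANY capsule-symmetric `ĉ` with
  `‖ĉ(v⃗)‖ = max_σ ‖c(v⃗∘σ)‖` — (Ind1) SYMMETRISES the scalars by the maximal norm over the capsule orbit (for idele
  boxes: the MINIMAL order `min_a ord(t_{v_a})` replaces `ord(t_{v_j})`); hence **`stable_thetaHull_of_scaled`**: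
  `hst` HOLDS at `(i+1, p)` — every `Φ ∈ indGroup` maps `^{n,∘}𝒰_{i+1,p}` onto itself — together with `HullDefined`
  (`hullDefined_of_scaled`);
* §3 the setting of record with SHARP idele boxes (`Real.settingDHVolSharp`, abc-iut-c312-3 p419746):
  **`stable_thetaHull_settingDHVolSharp_of_unramified`** — `hst` at `(i+1, p)` for every odd `p ∤ disc(F)` and
  ARBITRARY non-zero Θ-ideles (drops the unit hypothesis `h1` of p425664's `stable_thetaHull_settingDHVolSharp_of_good`
  and the rationality used by abc-iut-c312-10's `Cor312NotPointwiseDHVolSharp`; at an unramified place every idele has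
  norm in `p^ℤ`, `exists_norm_eq_norm_padic_zpow`), with the CLOSED FORM `thetaHull_settingDHVolSharp_eq_of_zpow`:
  `^{n,∘}𝒰_{i+1,p} = e⁻¹(Π_{v⃗} p^{min_a m(v_a)}·I_{v⃗})` when `‖t_{Θ,i+1,v}‖ = ‖p^{m(v)}‖`, and `HullDefined`
  (`hullDefined_settingDHVolSharp_of_unramified`).
So at the sharp setting of record `hst` (p424693) is now open ONLY at the primes dividing `2·disc(F)` (at a RAMIFIED
prime the typed (Ind2) = all lattice automorphisms of `I_v` can move `𝒪_L`: seat finding on HOME/STATUS, not asserted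
here). [claim: Mochizuki2012, status: disputed] for the quoted constructions; [cite: DupuyHilado2025, §3.9, §4.7, §4.9];
[cite: Mochizuki2012, IUTchIV Thm 1.10 proof Step (vi) p. 29]. Deliberately NOT here: volumes of the hull, any judgement.
-/

noncomputable section

open Set Function NumberField IsDedekindDomain Bornology
open scoped Pointwise

namespace Summit.ABC

namespace IUTFork

namespace Thm311

namespace Real

open Cor312 Cor312Vol Literature.IUT.LogThetaLattice Literature.IUT.LogVolume

variable {F : Type} [Field F] [NumberField F] (X : PilotData F) {logv : PadicLogs F} (hlog : LogvAnalytic logv)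

/-! ## 2. At `Real.settingDHVol` with summand-wise scaled DH boxes: the (Ind3)-region, the possible images, the hull -/

section Boxes

variable (B : ∀ (pp : Nat.Primes) (j : (thetaIndex X).Label)
    (e : (thetaIndex X).Caps j → (thetaIndex X).Fibre (.inr pp)),
    haveI : Fact (pp : ℕ).Prime := ⟨pp.2⟩; Set ((presAt X hlog pp).X e))
  (M : Type) [Field M] [NumberField M]
  (archPk : ∀ (j : (thetaIndex X).Label) (vQ : (thetaIndex X).VQ), Set ((logShellsDH X logv).Packet j vQ))
  (archSub : ∀ (j : (thetaIndex X).Label) (v : (thetaIndex X).V),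
    Set ((logShellsDH X logv).Packet j ((thetaIndex X).over v)))
  (Ψ : ℤ → ∀ v : (thetaIndex X).V, v ∈ (thetaIndex X).Vbad → Set ((logShellsDH X logv).StarPacket v))
  (act : ℤ → ∀ v : (thetaIndex X).V, v ∈ (thetaIndex X).Vbad →
    (logShellsDH X logv).StarPacket v → Module.End ℚ ((logShellsDH X logv).StarPacket v))
  (Mmod : ℤ → ∀ j : (thetaIndex X).LabelStar, Set ((logShellsDH X logv).GlobalPacket j.1))
  (region : ℤ → ∀ j : (thetaIndex X).LabelStar, FinDivisor M → ∀ vQ : (thetaIndex X).VQ,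
    Set ((logShellsDH X logv).Packet j.1 vQ))
  (n : ℤ) {HT : Type} {LogLink : HT → HT → Type} {IsFull : ∀ {s t : HT}, LogLink s t → Prop}
  (lat : LGPGaussianLogThetaLattice LogLink IsFull)
  {Frd : Type} {IsoF : Frd → Frd → Type} {Ob : Frd → Type} {realify : Frd → Frd} {Strip : Type}
  {IsoS : Strip → Strip → Type} {Mv : ∀ v : (thetaIndex X).V, v ∈ (thetaIndex X).Vbad → Type}
  [∀ v h, Monoid (Mv v h)]
  (sig : GlobalLGPFrobenioidSignature (thetaIndex X).lstar (thetaIndex X).V (· ∈ (thetaIndex X).Vbad)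
    Frd IsoF Ob realify Strip IsoS Mv)
  (split : SplittingMonoids Mv) {ObΔ : Type} {N : ∀ v : (thetaIndex X).V, v ∈ (thetaIndex X).Vbad → Type}
  [∀ v h, Monoid (N v h)] (qData : QPilotData ObΔ N)
  (qCentre : ObΔ → ∀ (j : (thetaIndex X).Label) (vQ : (thetaIndex X).VQ),
    ∀ s : factorIdxDH X hlog j vQ, factorFieldDH X hlog j vQ s)
  (hq : ∀ j vQ s, qCentre (qPilotObject qData) j vQ s ≠ 0)
  (hfin : ∀ j : (thetaIndex X).Label, (Function.support fun vQ =>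
    ((situationDHVol X hlog M archPk archSub Ψ act Mmod region).D n).logvol j vQ
      (factorMapDH X hlog j vQ ⁻¹' hullSet (factorFieldDH X hlog j vQ) (qCentre (qPilotObject qData) j vQ))).Finite)

/-- **The (Ind3)-region of the setting with DH boxes `B_{p,j,v⃗} = c(v⃗)·(R_{v⃗})^∼` at an unramified odd packet IS the
scaled lattice `e⁻¹(Π_{v⃗} c(v⃗)·I_{v⃗})`.** [cite: DupuyHilado2025, §3.9, §4.10] -/
theorem thetaRegion3_eq_latticePkS (i : Fin (thetaIndex X).lstar) (pp : Nat.Primes) [Fact (pp : ℕ).Prime]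
    (hp2 : 2 < (pp : ℕ)) (hdisc : ¬ ((pp : ℕ) : ℤ) ∣ NumberField.discr F)
    (c : ((thetaIndex X).Caps (Setting.labelSucc i) → (thetaIndex X).Fibre (.inr pp)) → ℚ_[pp])
    (hB : ∀ e, B pp (Setting.labelSucc i) e =
      c e • (normalizedPacket (pp : ℕ) ((presAt X hlog pp).kk e) : Set ((presAt X hlog pp).X e))) :
    (settingDHVol X hlog M archPk archSub Ψ act Mmod region n lat sig split qData
        (fun _ _ => thetaBoxDH X hlog B) qCentre hq hfin).thetaRegion3 (Setting.labelSucc i) (.inr pp) =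
      (presAt X hlog pp).latticePkS (Setting.labelSucc i) c := by
  rw [thetaRegion3_thetaBoxDH, (presAt X hlog pp).latticePkS_eq_of_unramified hp2 (two_le_card_caps_labelSucc X i)
    (absRamificationIdx_presAt_eq_one X hlog pp hdisc) c]
  show (fun x => (presAt X hlog pp).factorMap _ x) ⁻¹' (presAt X hlog pp).boxOf (B pp (Setting.labelSucc i)) = _
  rw [(presAt X hlog pp).factorMap_preimage_boxOf]
  congr 1
  exact Set.pi_congr rfl fun e _ => hB e

/-- **The union of ALL possible images at that packet is the union over the capsule permutations `σ` of
`e⁻¹(Π_{v⃗} c(v⃗∘σ)·I_{v⃗})`** ((Ind2) fixes, (Ind1) re-indexes; companion file). [cite: DupuyHilado2025, §4.7, §4.9] -/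
theorem sUnion_possibleImages_eq (i : Fin (thetaIndex X).lstar) (pp : Nat.Primes) [Fact (pp : ℕ).Prime]
    (hp2 : 2 < (pp : ℕ)) (hdisc : ¬ ((pp : ℕ) : ℤ) ∣ NumberField.discr F)
    (c : ((thetaIndex X).Caps (Setting.labelSucc i) → (thetaIndex X).Fibre (.inr pp)) → ℚ_[pp])
    (hB : ∀ e, B pp (Setting.labelSucc i) e =
      c e • (normalizedPacket (pp : ℕ) ((presAt X hlog pp).kk e) : Set ((presAt X hlog pp).X e))) :
    ⋃₀ (settingDHVol X hlog M archPk archSub Ψ act Mmod region n lat sig split qData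
        (fun _ _ => thetaBoxDH X hlog B) qCentre hq hfin).possibleImages (Setting.labelSucc i) (.inr pp) =
      ⋃ σ : Equiv.Perm ((thetaIndex X).Caps (Setting.labelSucc i)),
        (presAt X hlog pp).latticePkS (Setting.labelSucc i) (fun e => c (e ∘ ⇑σ)) := by
  unfold Setting.possibleImages
  rw [thetaRegion3_eq_latticePkS X hlog B M archPk archSub Ψ act Mmod region n lat sig split qData qCentre hq hfin i pp
    hp2 hdisc c hB]
  exact (presAt X hlog pp).sUnion_orbit_latticePkS c

/-- The image under the field-factor comparison of that union is the union of the hull-sets with block-constant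
centres `(c(v⃗∘σ))`. [cite: Mochizuki2012, IUTchIII Rmk. 3.9.5 (ii) p. 127] -/
theorem image_sUnion_possibleImages_eq (i : Fin (thetaIndex X).lstar) (pp : Nat.Primes) [Fact (pp : ℕ).Prime]
    (hp2 : 2 < (pp : ℕ)) (hdisc : ¬ ((pp : ℕ) : ℤ) ∣ NumberField.discr F)
    (c : ((thetaIndex X).Caps (Setting.labelSucc i) → (thetaIndex X).Fibre (.inr pp)) → ℚ_[pp])
    (hc : ∀ e, c e ≠ 0)
    (hB : ∀ e, B pp (Setting.labelSucc i) e =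
      c e • (normalizedPacket (pp : ℕ) ((presAt X hlog pp).kk e) : Set ((presAt X hlog pp).X e))) :
    factorMapDH X hlog (Setting.labelSucc i) (.inr pp) ''
        ⋃₀ (settingDHVol X hlog M archPk archSub Ψ act Mmod region n lat sig split qData
          (fun _ _ => thetaBoxDH X hlog B) qCentre hq hfin).possibleImages (Setting.labelSucc i) (.inr pp) =
      ⋃ σ : Equiv.Perm ((thetaIndex X).Caps (Setting.labelSucc i)),
        hullSet (factorFieldDH X hlog (Setting.labelSucc i) (.inr pp))
          ((presAt X hlog pp).centreOf fun e => algebraMap ℚ_[pp] ((presAt X hlog pp).X e) (c (e ∘ ⇑σ))) := by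
  refine (congrArg (Set.image (factorMapDH X hlog (Setting.labelSucc i) (.inr pp)))
    (sUnion_possibleImages_eq X hlog B M archPk archSub Ψ act Mmod region n lat sig split qData qCentre hq hfin i pp hp2
      hdisc c hB)).trans ?_
  rw [Set.image_iUnion]
  refine Set.iUnion_congr fun σ => ?_
  exact (presAt X hlog pp).image_factorMap_latticePkS_of_unramified hp2 (two_le_card_caps_labelSucc X i)
    (absRamificationIdx_presAt_eq_one X hlog pp hdisc) fun e => hc _

/-- **`^{n,∘}𝒰_{i+1,p} = e⁻¹(Π_{v⃗} ĉ(v⃗)·I_{v⃗})` — the holomorphic hull of the union of ALL possible images of a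
summand-wise `ℚ_p`-scaled box family at an unramified odd packet is the scaled lattice of ANY capsule-symmetric
majorant `ĉ` attained on the capsule orbit** (`‖ĉ(v⃗)‖ = max_σ ‖c(v⃗∘σ)‖`): (Ind1) symmetrises the scalars by the
maximal norm. [cite: Mochizuki2012, IUTchIV Thm 1.10 proof Step (vi) p. 29] -/
theorem thetaHull_eq_latticePkS (i : Fin (thetaIndex X).lstar) (pp : Nat.Primes) [Fact (pp : ℕ).Prime]
    (hp2 : 2 < (pp : ℕ)) (hdisc : ¬ ((pp : ℕ) : ℤ) ∣ NumberField.discr F)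
    (c : ((thetaIndex X).Caps (Setting.labelSucc i) → (thetaIndex X).Fibre (.inr pp)) → ℚ_[pp])
    (hc : ∀ e, c e ≠ 0)
    (hB : ∀ e, B pp (Setting.labelSucc i) e =
      c e • (normalizedPacket (pp : ℕ) ((presAt X hlog pp).kk e) : Set ((presAt X hlog pp).X e)))
    (ĉ : ((thetaIndex X).Caps (Setting.labelSucc i) → (thetaIndex X).Fibre (.inr pp)) → ℚ_[pp])
    (hĉ0 : ∀ e, ĉ e ≠ 0) (hle : ∀ (σ : Equiv.Perm _) e, ‖c (e ∘ ⇑σ)‖ ≤ ‖ĉ e‖)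
    (hatt : ∀ e, ∃ σ : Equiv.Perm _, ‖c (e ∘ ⇑σ)‖ = ‖ĉ e‖) :
    (settingDHVol X hlog M archPk archSub Ψ act Mmod region n lat sig split qData
        (fun _ _ => thetaBoxDH X hlog B) qCentre hq hfin).thetaHull (Setting.labelSucc i) (.inr pp) =
      (presAt X hlog pp).latticePkS (Setting.labelSucc i) ĉ := by
  haveI hF : Fintype ((presAt X hlog pp).factorIdx (Setting.labelSucc i)) :=
    factorIdxDH_fintype X hlog (Setting.labelSucc i) (.inr pp)
  have hj := two_le_card_caps_labelSucc X i
  have he := absRamificationIdx_presAt_eq_one X hlog pp hdisc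
  have hfU := image_sUnion_possibleImages_eq X hlog B M archPk archSub Ψ act Mmod region n lat sig split qData qCentre
    hq hfin i pp hp2 hdisc c hc hB
  have hb : Bornology.IsBounded (factorMapDH X hlog (Setting.labelSucc i) (.inr pp) ''
      ⋃₀ (settingDHVol X hlog M archPk archSub Ψ act Mmod region n lat sig split qData
          (fun _ _ => thetaBoxDH X hlog B) qCentre hq hfin).possibleImages (Setting.labelSucc i) (.inr pp)) := by
    rw [hfU]
    exact (presAt X hlog pp).isBounded_iUnion_hullSet_centreOf (fun (σ : Equiv.Perm _) e => c (e ∘ ⇑σ)) hle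
  have hnd : IsNondegenerate (factorFieldDH X hlog (Setting.labelSucc i) (.inr pp))
      (factorMapDH X hlog (Setting.labelSucc i) (.inr pp) ''
        ⋃₀ (settingDHVol X hlog M archPk archSub Ψ act Mmod region n lat sig split qData
          (fun _ _ => thetaBoxDH X hlog B) qCentre hq hfin).possibleImages (Setting.labelSucc i) (.inr pp)) := by
    rw [hfU]
    exact (presAt X hlog pp).isNondegenerate_iUnion_hullSet_centreOf (fun (σ : Equiv.Perm _) e => c (e ∘ ⇑σ))
      fun σ e => hc _
  show ((HullFrame.ofLocalFields (factorFieldDH X hlog (Setting.labelSucc i) (.inr pp))).comap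
      (factorMapDH X hlog (Setting.labelSucc i) (.inr pp))).hull
      (⋃₀ (settingDHVol X hlog M archPk archSub Ψ act Mmod region n lat sig split qData
          (fun _ _ => thetaBoxDH X hlog B) qCentre hq hfin).possibleImages (Setting.labelSucc i) (.inr pp)) = _
  rw [HullFrame.comap_hull _ _ hb, HullFrame.ofLocalFields_hull_eq _ hb hnd, hfU]
  show factorMapDH X hlog (Setting.labelSucc i) (.inr pp) ⁻¹'
      holomorphicHull ((presAt X hlog pp).factorField (Setting.labelSucc i))
        (⋃ σ : Equiv.Perm ((thetaIndex X).Caps (Setting.labelSucc i)),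
          hullSet ((presAt X hlog pp).factorField (Setting.labelSucc i))
            ((presAt X hlog pp).centreOf fun e => algebraMap ℚ_[pp] ((presAt X hlog pp).X e) (c (e ∘ ⇑σ)))) = _
  rw [(presAt X hlog pp).holomorphicHull_iUnion_hullSet_centreOf (fun (σ : Equiv.Perm _) e => c (e ∘ ⇑σ)) hĉ0 hle hatt]
  exact ((presAt X hlog pp).latticePkS_eq_preimage_hullSet_of_unramified hp2 hj he hĉ0).symm

/-- **ONE-SET STABILITY `hst` at an unramified odd packet for summand-wise `ℚ_p`-scaled boxes**: every element of
the indeterminacy group maps `^{n,∘}𝒰_{i+1,p}` onto itself (it is a capsule-SYMMETRIC scaled lattice). The hypothesis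
of abc-iut-w5-d060's `Cor312HullGluedStable` at this packet. [cite: DupuyHilado2025, §4.7, §4.9] -/
theorem stable_thetaHull_of_scaled (i : Fin (thetaIndex X).lstar) (pp : Nat.Primes) [Fact (pp : ℕ).Prime]
    (hp2 : 2 < (pp : ℕ)) (hdisc : ¬ ((pp : ℕ) : ℤ) ∣ NumberField.discr F)
    (c : ((thetaIndex X).Caps (Setting.labelSucc i) → (thetaIndex X).Fibre (.inr pp)) → ℚ_[pp])
    (hc : ∀ e, c e ≠ 0)
    (hB : ∀ e, B pp (Setting.labelSucc i) e =
      c e • (normalizedPacket (pp : ℕ) ((presAt X hlog pp).kk e) : Set ((presAt X hlog pp).X e)))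
    (ĉ : ((thetaIndex X).Caps (Setting.labelSucc i) → (thetaIndex X).Fibre (.inr pp)) → ℚ_[pp])
    (hĉ0 : ∀ e, ĉ e ≠ 0) (hsymm : ∀ (σ : Equiv.Perm _) e, ĉ (e ∘ ⇑σ) = ĉ e)
    (hle : ∀ (σ : Equiv.Perm _) e, ‖c (e ∘ ⇑σ)‖ ≤ ‖ĉ e‖) (hatt : ∀ e, ∃ σ : Equiv.Perm _, ‖c (e ∘ ⇑σ)‖ = ‖ĉ e‖) :
    ∀ Φ ∈ Setting.indGroup (situationDHVol X hlog M archPk archSub Ψ act Mmod region),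
      Φ (Setting.labelSucc i) (.inr pp) ''
          (settingDHVol X hlog M archPk archSub Ψ act Mmod region n lat sig split qData
            (fun _ _ => thetaBoxDH X hlog B) qCentre hq hfin).thetaHull (Setting.labelSucc i) (.inr pp) =
        (settingDHVol X hlog M archPk archSub Ψ act Mmod region n lat sig split qData
          (fun _ _ => thetaBoxDH X hlog B) qCentre hq hfin).thetaHull (Setting.labelSucc i) (.inr pp) := by
  intro Φ hΦ
  rw [thetaHull_eq_latticePkS X hlog B M archPk archSub Ψ act Mmod region n lat sig split qData qCentre hq hfin i pp hp2
    hdisc c hc hB ĉ hĉ0 hle hatt]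
  exact (presAt X hlog pp).image_latticePkS_of_mem_closure_of_symm hΦ _ hsymm

/-- `HullDefined` at that packet (the box is a hull-set: bounded and nondegenerate; gen 3 `hullDefined_settingDHVol_inr`).
[folklore] -/
theorem hullDefined_of_scaled (i : Fin (thetaIndex X).lstar) (pp : Nat.Primes) [Fact (pp : ℕ).Prime]
    (c : ((thetaIndex X).Caps (Setting.labelSucc i) → (thetaIndex X).Fibre (.inr pp)) → ℚ_[pp])
    (hc : ∀ e, c e ≠ 0)
    (hB : ∀ e, B pp (Setting.labelSucc i) e =
      c e • (normalizedPacket (pp : ℕ) ((presAt X hlog pp).kk e) : Set ((presAt X hlog pp).X e))) :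
    (settingDHVol X hlog M archPk archSub Ψ act Mmod region n lat sig split qData
        (fun _ _ => thetaBoxDH X hlog B) qCentre hq hfin).HullDefined (Setting.labelSucc i) (.inr pp) := by
  haveI : Nonempty ((thetaIndex X).Caps (Setting.labelSucc i)) := ⟨0⟩
  have hbox : (⋃ m : ℤ, (fun (_ : ℤ) (_ : Ob sig.Clgp) => thetaBoxDH X hlog B) m (thetaPilotObject sig split)
        (Setting.labelSucc i) (.inr pp)) =
      hullSet (factorFieldDH X hlog (Setting.labelSucc i) (.inr pp))
        ((presAt X hlog pp).centreOf fun e => algebraMap ℚ_[pp] ((presAt X hlog pp).X e) (c e)) := by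
    rw [Set.iUnion_const]
    show (presAt X hlog pp).boxOf (B pp (Setting.labelSucc i)) =
      hullSet ((presAt X hlog pp).factorField (Setting.labelSucc i))
        ((presAt X hlog pp).centreOf fun e => algebraMap ℚ_[pp] ((presAt X hlog pp).X e) (c e))
    rw [← (presAt X hlog pp).boxOf_smul_normalizedPacket _ fun e i =>
      dEquiv_algebraMap_ne_zero (pp : ℕ) ((presAt X hlog pp).kk e) (hc e) i]
    congr 1
    funext e
    rw [hB e]
    exact smul_set_eq_algebraMap_smul (pp : ℕ) ((presAt X hlog pp).kk e) (c e) _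
  have hH : IsHullSet (factorFieldDH X hlog (Setting.labelSucc i) (.inr pp))
      (hullSet (factorFieldDH X hlog (Setting.labelSucc i) (.inr pp))
        ((presAt X hlog pp).centreOf fun e => algebraMap ℚ_[pp] ((presAt X hlog pp).X e) (c e))) :=
    ⟨_, fun s => by
      rw [(presAt X hlog pp).centreOf_algebraMap_apply]
      exact (map_ne_zero (algebraMap ℚ_[pp] ((presAt X hlog pp).factorField (Setting.labelSucc i) s))).2 (hc s.1),
      rfl⟩
  exact hullDefined_settingDHVol_inr X hlog M archPk archSub Ψ act Mmod region n lat sig split qData _ qCentre hq hfin _ pp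
    (by rw [hbox]; exact hH.isBounded) (by rw [hbox]; exact hH.isNondegenerate)

end Boxes

/-! ## 3. The setting of record with SHARP idele boxes: `hst` at every unramified odd prime, arbitrary ideles -/

section Sharp

variable (t : ∀ (pp : Nat.Primes) (_ : Fin X.lstar) (x : (thetaIndex X).Fibre (.inr pp)),
    haveI : Fact (pp : ℕ).Prime := ⟨pp.2⟩; kOf X pp.1 x)
  (tq : ∀ (pp : Nat.Primes) (x : (thetaIndex X).Fibre (.inr pp)),
    haveI : Fact (pp : ℕ).Prime := ⟨pp.2⟩; kOf X pp.1 x)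
  (M : Type) [Field M] [NumberField M]
  (archPk : ∀ (j : (thetaIndex X).Label) (vQ : (thetaIndex X).VQ), Set ((logShellsDH X logv).Packet j vQ))
  (archSub : ∀ (j : (thetaIndex X).Label) (v : (thetaIndex X).V),
    Set ((logShellsDH X logv).Packet j ((thetaIndex X).over v)))
  (Ψ : ℤ → ∀ v : (thetaIndex X).V, v ∈ (thetaIndex X).Vbad → Set ((logShellsDH X logv).StarPacket v))
  (act : ℤ → ∀ v : (thetaIndex X).V, v ∈ (thetaIndex X).Vbad →
    (logShellsDH X logv).StarPacket v → Module.End ℚ ((logShellsDH X logv).StarPacket v))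
  (Mmod : ℤ → ∀ j : (thetaIndex X).LabelStar, Set ((logShellsDH X logv).GlobalPacket j.1))
  (region : ℤ → ∀ j : (thetaIndex X).LabelStar, FinDivisor M → ∀ vQ : (thetaIndex X).VQ,
    Set ((logShellsDH X logv).Packet j.1 vQ))
  (n : ℤ) {HT : Type} {LogLink : HT → HT → Type} {IsFull : ∀ {s t : HT}, LogLink s t → Prop}
  (lat : LGPGaussianLogThetaLattice LogLink IsFull)
  {Frd : Type} {IsoF : Frd → Frd → Type} {Ob : Frd → Type} {realify : Frd → Frd} {Strip : Type}
  {IsoS : Strip → Strip → Type} {Mv : ∀ v : (thetaIndex X).V, v ∈ (thetaIndex X).Vbad → Type}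
  [∀ v h, Monoid (Mv v h)]
  (sig : GlobalLGPFrobenioidSignature (thetaIndex X).lstar (thetaIndex X).V (· ∈ (thetaIndex X).Vbad)
    Frd IsoF Ob realify Strip IsoS Mv)
  (split : SplittingMonoids Mv) {ObΔ : Type} {N : ∀ v : (thetaIndex X).V, v ∈ (thetaIndex X).Vbad → Type}
  [∀ v h, Monoid (N v h)] (qData : QPilotData ObΔ N)

/-- The minimal exponent over the capsule coordinates, `min_a m(v_a)`, is capsule-symmetric. [folklore] -/
theorem inf'_comp_perm_eq {α β : Type} [Fintype α] [Nonempty α] [LinearOrder β] (g : α → β) (σ : Equiv.Perm α) :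
    Finset.univ.inf' Finset.univ_nonempty (g ∘ ⇑σ) = Finset.univ.inf' Finset.univ_nonempty g :=
  le_antisymm (Finset.le_inf' _ _ fun a _ => by simpa using Finset.inf'_le (g ∘ ⇑σ) (Finset.mem_univ (σ.symm a)))
    (Finset.le_inf' _ _ fun a _ => Finset.inf'_le g (Finset.mem_univ (σ a)))

/-- **At the SHARP setting of record, at an odd `p ∤ disc(F)` where the Θ-ideles at the places over `p` have norms
`‖t_{Θ,i+1,v}‖ = ‖p^{m(v)}‖` (automatic there, `exists_norm_eq_norm_padic_zpow`): `^{n,∘}𝒰_{i+1,p}` IS the scaled lattice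
`e⁻¹(Π_{v⃗} p^{min_a m(v_a)}·I_{v⃗})`** — (Ind1) replaces the exponent `m(v_j)` of the sharp box (idele through the last
factor, Dupuy–Hilado §3.9) by the MINIMUM over the capsule. [cite: DupuyHilado2025, §3.9, §4.7] -/
theorem thetaHull_settingDHVolSharp_eq_of_zpow (ht0 : ∀ pp i x, t pp i x ≠ 0) (htq0 : ∀ pp x, tq pp x ≠ 0)
    (htq1 : ∀ (pp : Nat.Primes) (x : (thetaIndex X).Fibre (.inr pp)),
      haveI : Fact (pp : ℕ).Prime := ⟨pp.2⟩; placeOf X pp.1 x ∉ X.S → ‖tq pp x‖ = 1)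
    (i : Fin (thetaIndex X).lstar) (pp : Nat.Primes) [Fact (pp : ℕ).Prime] (hp2 : 2 < (pp : ℕ))
    (hdisc : ¬ ((pp : ℕ) : ℤ) ∣ NumberField.discr F)
    (m : (thetaIndex X).Fibre (.inr pp) → ℤ) (hm : ∀ x, ‖t pp i x‖ = ‖((pp : ℕ) : ℚ_[pp]) ^ m x‖) :
    (settingDHVolSharp X hlog M archPk archSub Ψ act Mmod region n lat sig split qData tq t htq0
        htq1).thetaHull (Setting.labelSucc i) (.inr pp) =
      (presAt X hlog pp).latticePkS (Setting.labelSucc i) fun e =>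
        ((pp : ℕ) : ℚ_[pp]) ^ Finset.univ.inf' Finset.univ_nonempty (fun a => m (e a)) := by
  haveI : Nonempty ((thetaIndex X).Caps (Setting.labelSucc i)) := ⟨0⟩
  have hpQ : ((pp : ℕ) : ℚ_[pp]) ≠ 0 := Nat.cast_ne_zero.mpr pp.2.ne_zero
  have hp1 : 1 < ((pp : ℕ) : ℝ) := by exact_mod_cast pp.2.one_lt
  have hnorm : ∀ a b : ℤ, ‖((pp : ℕ) : ℚ_[pp]) ^ a‖ ≤ ‖((pp : ℕ) : ℚ_[pp]) ^ b‖ ↔ b ≤ a := by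
    intro a b
    rw [norm_zpow, norm_zpow, Padic.norm_p, inv_zpow', inv_zpow', zpow_le_zpow_iff_right₀ hp1, neg_le_neg_iff]
  refine thetaHull_eq_latticePkS X hlog _ M archPk archSub Ψ act Mmod region n lat sig split qData _ _ _ i pp hp2 hdisc
    (fun e => ((pp : ℕ) : ℚ_[pp]) ^ m (e (Fin.last _))) (fun e => zpow_ne_zero _ hpQ) (fun e => ?_) _
    (fun e => zpow_ne_zero _ hpQ) (fun σ e => ?_) (fun e => ?_)
  · -- the sharp box at `(i+1, p, v⃗)` is `p^{m(v_{i+1})}·(R_{v⃗})^∼`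
    show sharpBoxDH X hlog t pp (Setting.labelSucc i) e = _
    unfold sharpBoxDH
    rw [labelIdele_labelSucc]
    exact (presAt X hlog pp).iota_smul_normalizedPacket_eq_smul e (Fin.last _) (ht0 pp i _) (hm _)
  · -- `‖p^{m(v_{σ(i+1)})}‖ ≤ ‖p^{min_a m(v_a)}‖`
    rw [hnorm]
    exact Finset.inf'_le (fun a => m (e a)) (Finset.mem_univ (σ (Fin.last _)))
  · -- the minimum is attained: swap the last coordinate with a minimising one
    obtain ⟨a₀, -, ha₀⟩ := Finset.exists_min_image Finset.univ (fun a => m (e a)) Finset.univ_nonempty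
    refine ⟨Equiv.swap (Fin.last _) a₀, ?_⟩
    have hmin : Finset.univ.inf' Finset.univ_nonempty (fun a => m (e a)) = m (e a₀) :=
      le_antisymm (Finset.inf'_le _ (Finset.mem_univ a₀)) (Finset.le_inf' _ _ fun a _ => ha₀ a (Finset.mem_univ a))
    show ‖((pp : ℕ) : ℚ_[pp]) ^ m (e (Equiv.swap (Fin.last _) a₀ (Fin.last _)))‖ = _
    rw [Equiv.swap_apply_left, hmin]

/-- **… and `^{n,∘}𝒰_{i+1,p}` is (Ind1),(Ind2)-STABLE there** (`hst` of abc-iut-w5-d060's `Cor312HullGluedStable` at this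
packet of the sharp setting of record). [cite: DupuyHilado2025, §4.7, §4.9] -/
theorem stable_thetaHull_settingDHVolSharp_of_zpow (ht0 : ∀ pp i x, t pp i x ≠ 0) (htq0 : ∀ pp x, tq pp x ≠ 0)
    (htq1 : ∀ (pp : Nat.Primes) (x : (thetaIndex X).Fibre (.inr pp)),
      haveI : Fact (pp : ℕ).Prime := ⟨pp.2⟩; placeOf X pp.1 x ∉ X.S → ‖tq pp x‖ = 1)
    (i : Fin (thetaIndex X).lstar) (pp : Nat.Primes) [Fact (pp : ℕ).Prime] (hp2 : 2 < (pp : ℕ))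
    (hdisc : ¬ ((pp : ℕ) : ℤ) ∣ NumberField.discr F)
    (m : (thetaIndex X).Fibre (.inr pp) → ℤ) (hm : ∀ x, ‖t pp i x‖ = ‖((pp : ℕ) : ℚ_[pp]) ^ m x‖) :
    ∀ Φ ∈ Setting.indGroup (situationDHVol X hlog M archPk archSub Ψ act Mmod region),
      Φ (Setting.labelSucc i) (.inr pp) ''
          (settingDHVolSharp X hlog M archPk archSub Ψ act Mmod region n lat sig split qData tq t htq0
            htq1).thetaHull (Setting.labelSucc i) (.inr pp) =
        (settingDHVolSharp X hlog M archPk archSub Ψ act Mmod region n lat sig split qData tq t htq0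
          htq1).thetaHull (Setting.labelSucc i) (.inr pp) := by
  intro Φ hΦ
  rw [thetaHull_settingDHVolSharp_eq_of_zpow X hlog t tq M archPk archSub Ψ act Mmod region n lat sig split qData ht0 htq0
    htq1 i pp hp2 hdisc m hm]
  refine (presAt X hlog pp).image_latticePkS_of_mem_closure_of_symm hΦ _ fun σ e => ?_
  show ((pp : ℕ) : ℚ_[pp]) ^ Finset.univ.inf' Finset.univ_nonempty (fun a => m ((e ∘ ⇑σ) a)) = _
  rw [show (fun a => m ((e ∘ ⇑σ) a)) = (fun a => m (e a)) ∘ ⇑σ from rfl, inf'_comp_perm_eq]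

/-- **`hst` at EVERY odd `p ∤ disc(F)` for ARBITRARY non-zero Θ-ideles at the sharp setting of record** (no unit or
rationality hypothesis: at an unramified place every idele has norm in `p^ℤ`). With abc-iut-w5-d060's p425664
(`hst` at the unit-box packets) this leaves the one-set stability hypothesis of `Cor312HullGluedStable` open at the
sharp setting of record ONLY at the primes dividing `2·disc(F)`. [cite: DupuyHilado2025, §3.9, §4.7, §4.9] -/
theorem stable_thetaHull_settingDHVolSharp_of_unramified (ht0 : ∀ pp i x, t pp i x ≠ 0) (htq0 : ∀ pp x, tq pp x ≠ 0)
    (htq1 : ∀ (pp : Nat.Primes) (x : (thetaIndex X).Fibre (.inr pp)),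
      haveI : Fact (pp : ℕ).Prime := ⟨pp.2⟩; placeOf X pp.1 x ∉ X.S → ‖tq pp x‖ = 1)
    (i : Fin (thetaIndex X).lstar) (pp : Nat.Primes) (hp2 : 2 < (pp : ℕ))
    (hdisc : ¬ ((pp : ℕ) : ℤ) ∣ NumberField.discr F) :
    ∀ Φ ∈ Setting.indGroup (situationDHVol X hlog M archPk archSub Ψ act Mmod region),
      Φ (Setting.labelSucc i) (.inr pp) ''
          (settingDHVolSharp X hlog M archPk archSub Ψ act Mmod region n lat sig split qData tq t htq0
            htq1).thetaHull (Setting.labelSucc i) (.inr pp) =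
        (settingDHVolSharp X hlog M archPk archSub Ψ act Mmod region n lat sig split qData tq t htq0
          htq1).thetaHull (Setting.labelSucc i) (.inr pp) := by
  haveI : Fact (pp : ℕ).Prime := ⟨pp.2⟩
  have he := absRamificationIdx_presAt_eq_one X hlog pp hdisc
  choose m hm using fun x : (thetaIndex X).Fibre (.inr pp) =>
    exists_norm_eq_norm_padic_zpow (pp : ℕ) ((presAt X hlog pp).k x) (he x) (ht0 pp i x)
  exact stable_thetaHull_settingDHVolSharp_of_zpow X hlog t tq M archPk archSub Ψ act Mmod region n lat sig split qData
    ht0 htq0 htq1 i pp hp2 hdisc m hm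

/-- `HullDefined` at such a packet of the sharp setting (the box is a hull-set). [folklore] -/
theorem hullDefined_settingDHVolSharp_of_unramified (ht0 : ∀ pp i x, t pp i x ≠ 0) (htq0 : ∀ pp x, tq pp x ≠ 0)
    (htq1 : ∀ (pp : Nat.Primes) (x : (thetaIndex X).Fibre (.inr pp)),
      haveI : Fact (pp : ℕ).Prime := ⟨pp.2⟩; placeOf X pp.1 x ∉ X.S → ‖tq pp x‖ = 1)
    (i : Fin (thetaIndex X).lstar) (pp : Nat.Primes) (hdisc : ¬ ((pp : ℕ) : ℤ) ∣ NumberField.discr F) :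
    (settingDHVolSharp X hlog M archPk archSub Ψ act Mmod region n lat sig split qData tq t htq0
        htq1).HullDefined (Setting.labelSucc i) (.inr pp) := by
  haveI : Fact (pp : ℕ).Prime := ⟨pp.2⟩
  have hpQ : ((pp : ℕ) : ℚ_[pp]) ≠ 0 := Nat.cast_ne_zero.mpr pp.2.ne_zero
  have he := absRamificationIdx_presAt_eq_one X hlog pp hdisc
  choose m hm using fun x : (thetaIndex X).Fibre (.inr pp) =>
    exists_norm_eq_norm_padic_zpow (pp : ℕ) ((presAt X hlog pp).k x) (he x) (ht0 pp i x)
  refine hullDefined_of_scaled X hlog _ M archPk archSub Ψ act Mmod region n lat sig split qData _ _ _ i pp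
    (fun e => ((pp : ℕ) : ℚ_[pp]) ^ m (e (Fin.last _))) (fun e => zpow_ne_zero _ hpQ) fun e => ?_
  show sharpBoxDH X hlog t pp (Setting.labelSucc i) e = _
  unfold sharpBoxDH
  rw [labelIdele_labelSucc]
  exact (presAt X hlog pp).iota_smul_normalizedPacket_eq_smul e (Fin.last _) (ht0 pp i _) (hm _)

end Sharp

end Real

end Thm311

end IUTFork

end Summit.ABC

end
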